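import Literature.Computability.Cryptography.RegevReductionCVPLiftChain
import Literature.Computability.Cryptography.RegevReductionCVPSplit
import Literature.Computability.QuantumComplexity.CWrapKernelRel
import HarnessLib

/-!
# Regev 2009, Lemma 3.5 — `A_lift` reduced to its classical stage functions

Literature first-formalisation unit `b2b-lwe-3` (generation 6, fourth module), bundle
`papers/QuantumAdvantage/lwe-quantum-autopsy/`.  THE VALUE of this file is a THEOREM about a KNOWN
reduction (O. Regev, *On lattices, learning with errors, random linear codes, and cryptography*, J. ACM 56
(2009), Lemma 3.5: `CVP_{L*,d}` from `CVP^{(q)}_{L*,d}` by digit extraction, division by `q`, and an exact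
LLL/nearest-plane finish) — NOT progress on any open problem and NOT summit progress.

## What this file proves (theorems only; no definition, no named fact, no `sorry`)

The residual named fact `A_lift = regev2009_lemma_3_5_liftFamily q` (`RegevReductionCVPSplit.lean`) asks,
for every candidate digit solver `T`, for ONE uniform family `R` whose failure on the `CVP_{L*,d}` query of
an admissible datum `c` is at most `C · Σ_{i < p_R(n)} (failure of T on the true iterate x_i) + ν(n)`.
Its lattice arithmetic is proved in `RegevReductionCVPLiftExact.lean`, its union bound / loop principle in
`RegevReductionCVPLiftChain.lean`.  Here the two are joined to the tree's CLASSICAL WRAP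
(`QuantumComplexity/CWrap*.lean`: `CWrap.exists_params`, `CWrap.family`, `CWrap.family_isOracleFree`,
`CWrap.family_isUniform`, `CWrap.kernelProb_family_ge_rel` — "deterministic polynomial-time computation
is free inside a quantum circuit family", Bernstein–Vazirani 1997 §8), reducing `A_lift` to statements
with NO quantum content:

* `Regev2009.exists_wrapFamily` — for a uniform oracle-free family `T` and `h, g ∈ FP` there is a uniform
  oracle-free STAGE FAMILY `S` with `T.kernelProb (h u) R ≤ S.kernelProb u {z | ∃ y ∈ R, g ⟨u, y⟩ <+: z}`
  for every input `u` and event `R` (the kernel form of the classical wrap, packaged as a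
  `UniformQCircuitFamily`);
* `Regev2009.wrap_stage_fail_le`, `…_le_failProb`, `…_idle` — consequently, if `g ⟨u, y⟩ = good` for
  every `y` in `R` and `|good| = m`, the stage hands over a window `≠ good` with probability
  `≤ 1 − T.kernelProb (h u) R`; with `h u =` the digit-oracle query of `t` and `R =` "starts with the
  digit table of `t`" this is `≤ DigitOracle.failProb T q I ρ k y t`, and a stage whose `g` ignores `y`
  never fails;
* **`regev2009_lemma_3_5_liftFamily_of_goodStages`** — `A_lift` follows from: for every `T`, a uniform
  stage family `S` and polynomials `Ts` (stages), `ms` (window width), `p_R` such that, eventually in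
  `n`, every admissible query admits a GOOD PATH of windows `g 0 = [], g 1, …` whose last window starts
  with the required answer table and whose `i`-th stage fails with probability `≤ failProb T … (x_i)`
  for `i < p_R(n)` and `0` otherwise (proof: `Regev2009.exists_chainFamily_goodPath`, `C = 1`, `ν = 0`);
* **`regev2009_lemma_3_5_liftFamily_of_wrapFns`** — `A_lift` follows from the existence, for every `T`,
  of two CLASSICAL functions `h, g ∈ FP` (pre-processing: window ↦ the digit-oracle query of the current
  iterate; post-processing: (window, oracle answer) ↦ next window, the last one doing the exact finish)
  together with the good path of windows satisfying purely equational specifications: `h` maps the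
  `i`-th good stage input to `DigitOracle.query I ρ k y (x_i)`, `g` maps it, paired with ANY string
  starting with the true digit table of `x_i`, to the next good window (of the prescribed width), idle
  stages copy, and the last good window starts with `CVPOracle.answerTable I c` (which is what
  `DigitOracle.coords_eq_of_isLLLReduced` of `RegevReductionCVPLiftExact.lean` computes).

So after this file a proof of `A_lift` is a matter of WRITING two polynomial-time programs (in the tree's
`CodeFP` idiom, cf. `RegevRoutine.lean`, `BabaiListProgram.lean`, `IrreducibilityLLL*.lean`) and proving
their defining equations — no probability, no quantum circuits, no lattice geometry remain.

## References

* O. Regev, *On lattices, learning with errors, random linear codes, and cryptography*, J. ACM 56(6)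
  (2009), Lemma 3.5 (p. 16 of the author's version arXiv:2401.03703). [Regev2009] [RegevLWE2009]
* E. Bernstein, U. Vazirani, *Quantum complexity theory*, SIAM J. Comput. 26 (1997), §8 (classical
  computation inside quantum machines; subroutine composition). [BernsteinVazirani1997]
* M. A. Nielsen, I. L. Chuang, *Quantum Computation and Quantum Information*, CUP 2010, §3.2.5, §4.4.
  [NielsenChuang2010]
* L. Babai, *On Lovász' lattice reduction and the nearest lattice point problem*, Combinatorica 6 (1986).
  [Babai1986]
-/

noncomputable section

namespace Literature.Computability.Cryptography

open Filter _root_.Computability Literature.Computability.Complexity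
  Literature.Algebra.EuclideanLattices Literature.Computability.QuantumComplexity
  Literature.Computability.Cryptography.LWE
open scoped ENNReal

namespace Regev2009

/-! ### Windows of exact width; complements of kernel probabilities -/

/-- A prefix of length `m` is the zero-padded window of width `m`. [folklore] -/
theorem takeD_eq_of_prefix {a w : List Bool} (h : a <+: w) {m : ℕ} (hm : a.length = m) :
    w.takeD m false = a := by
  subst hm
  rw [List.takeD_eq_take _ h.length_le]
  exact (List.prefix_iff_eq_take.1 h).symm

/-- The kernel probability of the complement. [folklore] -/
theorem kernelProb_compl (S : UniformQCircuitFamily) (x : List Bool) (E : Set (List Bool)) :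
    S.kernelProb x Eᶜ = 1 - S.kernelProb x E := by
  have hfin : ∀ A : Set (List Bool), (S.kernel x).toOuterMeasure A ≠ ⊤ := fun A =>
    ne_top_of_le_ne_top ENNReal.one_ne_top (Literature.Probability.Moments.pmf_toOuterMeasure_le_one _ _)
  have h := congrArg ENNReal.toReal (toOuterMeasure_add_compl (S.kernel x) E)
  rw [ENNReal.toReal_add (hfin _) (hfin _), ENNReal.toReal_one] at h
  rw [UniformQCircuitFamily.kernelProb_eq, UniformQCircuitFamily.kernelProb_eq]
  linarith

/-- The kernel probability of the sure event is `1`. [folklore] -/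
theorem kernelProb_univ (S : UniformQCircuitFamily) (x : List Bool) : S.kernelProb x Set.univ = 1 := by
  have h := kernelProb_compl S x ∅
  rw [Set.compl_empty] at h
  rw [h, UniformQCircuitFamily.kernelProb_eq]
  simp

/-! ### The classical wrap as a stage family -/

/-- **The classical wrap of a uniform oracle-free family, in kernel form** (the tree's `CWrap.family`:
compute `h u` cleanly, route it into the matching copy of `T`, run it, compute `g` cleanly on everything,
swap its output to the front): there is ONE uniform oracle-free family `S` such that for every input `u`
and every event `R`, `S` on `u` prints a string with a prefix `g ⟨u, y⟩`, `y ∈ R`, at least as often as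
`T` on `h u` prints a string of `R`.
[cite: BernsteinVazirani1997, §8 (classical computation inside quantum machines)] [cite: NielsenChuang2010, §3.2.5, §4.4] -/
theorem exists_wrapFamily (T : UniformQCircuitFamily) {h g : List Bool → List Bool} (hh : h ∈ FP) (hg : g ∈ FP) :
    ∃ S : UniformQCircuitFamily, ∀ (u : List Bool) (R : Set (List Bool)),
      T.kernelProb (h u) R ≤ S.kernelProb u {z | ∃ y ∈ R, g (boolPair u y) <+: z} := by
  obtain ⟨P, hPh, hPg, hPF⟩ := CWrap.exists_params hh hg T.isUniform
  subst hPh hPg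
  have hOF : P.F.IsOracleFree := hPF ▸ T.isOracleFree
  have hU : P.F.IsUniform := hPF ▸ T.isUniform
  refine ⟨⟨CWrap.family P, CWrap.family_isOracleFree P hOF, CWrap.family_isUniform P hU⟩, fun u R => ?_⟩
  have h1 := CWrap.kernelProb_family_ge_rel P u 0 (fun _ => R)
  rw [hPF] at h1
  exact h1

/-- **A wrapped stage fails at most as often as the wrapped solver**: if the post-processor maps every
answer of the event `R` to the same window `good` of width `m`, the stage hands over a window `≠ good` with
probability `≤ 1 − T.kernelProb (h u) R`. [cite: BernsteinVazirani1997, §8] -/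
theorem wrap_stage_fail_le {S T : UniformQCircuitFamily} {h g : List Bool → List Bool} {u : List Bool}
    {R : Set (List Bool)} (hST : T.kernelProb (h u) R ≤ S.kernelProb u {z | ∃ y ∈ R, g (boolPair u y) <+: z})
    {good : List Bool} {m : ℕ} (hgood : ∀ y ∈ R, g (boolPair u y) = good) (hm : good.length = m) :
    S.kernelProb u {w | w.takeD m false ≠ good} ≤ 1 - T.kernelProb (h u) R := by
  have hsub : {z | ∃ y ∈ R, g (boolPair u y) <+: z} ⊆ {w | w.takeD m false = good} := by
    rintro z ⟨y, hy, hz⟩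
    rw [hgood y hy] at hz
    exact takeD_eq_of_prefix hz hm
  have h2 : T.kernelProb (h u) R ≤ S.kernelProb u {w | w.takeD m false = good} :=
    hST.trans (S.kernelProb_mono u hsub)
  have h3 : S.kernelProb u {w | w.takeD m false ≠ good} = 1 - S.kernelProb u {w | w.takeD m false = good} := by
    rw [← kernelProb_compl]
    rfl
  linarith

/-- **Specialisation to the digit oracle**: if `h` maps the stage input `u` to the query of `t` and `g`
maps `u` paired with any string starting with the digit table of `t` to `good`, the stage hands over a
window `≠ good` with probability `≤ DigitOracle.failProb T q I ρ k y t`.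
[cite: Regev2009, Lemma 3.5 (proof: "this sequence can be computed by using the oracle")] -/
theorem wrap_stage_fail_le_failProb {S T : UniformQCircuitFamily} {h g : List Bool → List Bool}
    (hST : ∀ (u : List Bool) (R : Set (List Bool)),
      T.kernelProb (h u) R ≤ S.kernelProb u {z | ∃ y ∈ R, g (boolPair u y) <+: z})
    {q : ℕ} {I : LatticeInstance} {ρ : ℚ} {k : ℕ} {y : List Bool} {t : Fin I.n → ℚ} {u : List Bool}
    (hu : h u = DigitOracle.query I ρ k y t) {good : List Bool} {m : ℕ}
    (hgood : ∀ yy : List Bool, DigitOracle.answerTable q I t <+: yy → g (boolPair u yy) = good)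
    (hm : good.length = m) :
    S.kernelProb u {w | w.takeD m false ≠ good} ≤ DigitOracle.failProb T q I ρ k y t := by
  have h1 := wrap_stage_fail_le (hST u {s | DigitOracle.answerTable q I t <+: s}) (fun yy hyy => hgood yy hyy) hm
  rw [hu] at h1
  exact h1

/-- **An idle stage never fails**: if `g` maps `u` paired with ANY answer to `good`, the stage hands over a
window `≠ good` with probability `0`. [folklore] -/
theorem wrap_stage_fail_idle {S T : UniformQCircuitFamily} {h g : List Bool → List Bool}
    (hST : ∀ (u : List Bool) (R : Set (List Bool)),
      T.kernelProb (h u) R ≤ S.kernelProb u {z | ∃ y ∈ R, g (boolPair u y) <+: z})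
    {u good : List Bool} {m : ℕ} (hgood : ∀ yy : List Bool, g (boolPair u yy) = good) (hm : good.length = m) :
    S.kernelProb u {w | w.takeD m false ≠ good} ≤ 0 := by
  have h1 := wrap_stage_fail_le (hST u Set.univ) (fun yy _ => hgood yy) hm
  rw [kernelProb_univ] at h1
  linarith

end Regev2009

/-! ### `A_lift` from good stages, and from the classical stage functions -/

section LiftStages

variable (q : ℕ → ℕ)

open Regev2009 Regev2009.DigitOracle

/-- **`A_lift` from a stage family with a good path** (Regev's Lemma 3.5, probabilistic assembly): if for
every digit solver `T` there are a uniform stage family `S` and polynomials `Ts` (number of stages), `ms`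
(window width), `p_R` such that, for all large `n` and every admissible query `x = CVPOracle.query I ρ k y c`,
there is a good path of windows `g` (`g 0 = []`) whose last window `g (Ts |x|)` starts with
`CVPOracle.answerTable I c` and whose `i`-th stage, run on `⟨x, ⟨1^i, g i⟩⟩`, hands over a window
`≠ g (i+1)` with probability `≤ DigitOracle.failProb T (q n) I ρ k y (x_i)` (`x_i` the true `i`-th iterate)
when `i < p_R(n)` and `≤ 0` otherwise — then `A_lift` holds, with `R :=` the chained family of
`Regev2009.exists_chainFamily_goodPath`, `C = 1`, `ν = 0`.
[cite: Regev2009, Lemma 3.5 (p. 16) and its proof] [cite: BernsteinVazirani1997, §8] -/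
theorem regev2009_lemma_3_5_liftFamily_of_goodStages
    (hS : PolyTimeComputable unaryEncodeNat encodeNat q → (∀ᶠ n : ℕ in atTop, 2 ≤ q n) →
      ∀ T : UniformQCircuitFamily, ∃ (S : UniformQCircuitFamily) (Ts ms pR : Polynomial ℕ),
        ∀ᶠ n : ℕ in atTop, ∀ (I : LatticeInstance) (ρ : ℚ) (k : ℕ) (y : List Bool), I.n = n → I.IsNonsingular →
          ∀ d : ℝ, d < minNorm (dualLattice I.lattice) / 2 →
          ∀ c : CVPOracle.QData I.n, CVPOracle.Admissible I d c →
            ∃ g : ℕ → List Bool, g 0 = [] ∧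
              CVPOracle.answerTable I c <+: g (Ts.eval (CVPOracle.query I ρ k y c).length) ∧
              ∀ i < Ts.eval (CVPOracle.query I ρ k y c).length,
                S.kernelProb (stageInput (CVPOracle.query I ρ k y c) i (g i))
                    {w | w.takeD (ms.eval (CVPOracle.query I ρ k y c).length) false ≠ g (i + 1)} ≤
                  if i < pR.eval n then failProb T (q n) I ρ k y (iter (q n) I (ratOf c) i) else 0) :
    regev2009_lemma_3_5_liftFamily q := by
  intro hq h2 T
  obtain ⟨S, Ts, ms, pR, hev⟩ := hS hq h2 T
  obtain ⟨D, hD⟩ := exists_chainFamily_goodPath S Ts ms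
  refine ⟨D, pR, 1, 0, isNegligible_zero, ?_⟩
  filter_upwards [hev] with n hn I ρ k y hIn hI d hd c hc
  obtain ⟨g, hg0, hpre, hst⟩ := hn I ρ k y hIn hI d hd c hc
  set x := CVPOracle.query I ρ k y c with hx
  set F : ℕ → ℝ := fun i => failProb T (q n) I ρ k y (iter (q n) I (ratOf c) i) with hF
  set f : ℕ → ℝ := fun i => if i < pR.eval n then F i else 0 with hf
  have hf0 : ∀ i, 0 ≤ f i := fun i => by
    simp only [hf]
    split_ifs
    · exact failProb_nonneg ..
    · exact le_rfl
  have hmain := hD x g hg0 f hf0 (fun i hi => hst i hi) _ hpre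
  have hsum : ∑ i ∈ Finset.range (Ts.eval x.length), f i ≤ ∑ i ∈ Finset.range (pR.eval n), F i := by
    rw [Finset.sum_ite, Finset.sum_const_zero, add_zero]
    refine Finset.sum_le_sum_of_subset_of_nonneg (fun i hi => ?_) fun i _ _ => failProb_nonneg ..
    rw [Finset.mem_filter] at hi
    exact Finset.mem_range.2 hi.2
  show 1 - D.kernelProb x {s | CVPOracle.answerTable I c <+: s} ≤ 1 * ∑ i ∈ Finset.range (pR.eval n), F i + (0 : ℕ → ℝ) n
  rw [one_mul, Pi.zero_apply, add_zero]
  exact hmain.trans hsum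

/-- **`A_lift` from its two classical stage functions** (Regev's Lemma 3.5 with the machine content made
explicit): suppose that for every digit solver `T` there are `h, g ∈ FP` and polynomials `Ts`, `ms`, `p_R`
such that, for all large `n` and every admissible query `x = CVPOracle.query I ρ k y c`, there is a good
path of windows `g_0 = [], g_1, …` with: the last window `g_{Ts |x|}` starts with `CVPOracle.answerTable I c`;
every window `g_{i+1}` (`i < Ts |x|`) has width `ms |x|`; and each stage `i < Ts |x|` is EITHER a working
stage — `i < p_R(n)`, `h ⟨x, ⟨1^i, g_i⟩⟩` is the digit-oracle query of the true iterate `x_i`, and `g` maps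
`⟨⟨x, ⟨1^i, g_i⟩⟩, yy⟩` to `g_{i+1}` for EVERY `yy` starting with the true digit table of `x_i` — OR an idle
stage — `g` maps `⟨⟨x, ⟨1^i, g_i⟩⟩, yy⟩` to `g_{i+1}` for every `yy`.  Then `A_lift` holds (the stage family
is the classical wrap `Regev2009.exists_wrapFamily` of `T` by `h`, `g`).
[cite: Regev2009, Lemma 3.5 (p. 16) and its proof] [cite: BernsteinVazirani1997, §8] [cite: Babai1986] -/
theorem regev2009_lemma_3_5_liftFamily_of_wrapFns
    (hW : PolyTimeComputable unaryEncodeNat encodeNat q → (∀ᶠ n : ℕ in atTop, 2 ≤ q n) →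
      ∀ T : UniformQCircuitFamily, ∃ (h g : List Bool → List Bool), h ∈ FP ∧ g ∈ FP ∧
        ∃ (Ts ms pR : Polynomial ℕ),
        ∀ᶠ n : ℕ in atTop, ∀ (I : LatticeInstance) (ρ : ℚ) (k : ℕ) (y : List Bool), I.n = n → I.IsNonsingular →
          ∀ d : ℝ, d < minNorm (dualLattice I.lattice) / 2 →
          ∀ c : CVPOracle.QData I.n, CVPOracle.Admissible I d c →
            ∃ gw : ℕ → List Bool, gw 0 = [] ∧
              CVPOracle.answerTable I c <+: gw (Ts.eval (CVPOracle.query I ρ k y c).length) ∧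
              ∀ i < Ts.eval (CVPOracle.query I ρ k y c).length,
                (gw (i + 1)).length = ms.eval (CVPOracle.query I ρ k y c).length ∧
                ((i < pR.eval n ∧
                    h (stageInput (CVPOracle.query I ρ k y c) i (gw i)) =
                      query I ρ k y (iter (q n) I (ratOf c) i) ∧
                    ∀ yy : List Bool, answerTable (q n) I (iter (q n) I (ratOf c) i) <+: yy →
                      g (boolPair (stageInput (CVPOracle.query I ρ k y c) i (gw i)) yy) = gw (i + 1)) ∨
                  ∀ yy : List Bool, g (boolPair (stageInput (CVPOracle.query I ρ k y c) i (gw i)) yy) = gw (i + 1))) :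
    regev2009_lemma_3_5_liftFamily q := by
  refine regev2009_lemma_3_5_liftFamily_of_goodStages q fun hq h2 T => ?_
  obtain ⟨h, g, hh, hg, Ts, ms, pR, hev⟩ := hW hq h2 T
  obtain ⟨S, hS⟩ := exists_wrapFamily T hh hg
  refine ⟨S, Ts, ms, pR, ?_⟩
  filter_upwards [hev] with n hn I ρ k y hIn hI d hd c hc
  obtain ⟨gw, h0, hpre, hst⟩ := hn I ρ k y hIn hI d hd c hc
  refine ⟨gw, h0, hpre, fun i hi => ?_⟩
  obtain ⟨hlen, hcase⟩ := hst i hi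
  rcases hcase with ⟨hip, hhu, hgg⟩ | hgg
  · rw [if_pos hip]
    exact wrap_stage_fail_le_failProb hS hhu hgg hlen
  · have h0' := wrap_stage_fail_idle hS hgg hlen
    split_ifs
    · exact h0'.trans (failProb_nonneg ..)
    · exact h0'

end LiftStages

end Literature.Computability.Cryptography

end
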